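import Mathlib.Analysis.Calculus.ParametricIntegral        -- `hasDerivAt_integral_of_dominated_loc_of_deriv_le`
import Mathlib.Analysis.Calculus.FDeriv.Extend              -- `hasDerivWithinAt_Ici_of_tendsto_deriv`
import Mathlib.Analysis.Calculus.ContDiff.RCLike
import Mathlib.Analysis.Calculus.ContDiff.Deriv             -- `contDiffOn_succ_iff_derivWithin`
import Literature.Geometry.ComplexHyperbolic.UnitBallSheetFamilyBounds   -- ★ part 1: majorants uniform in `t`
import HarnessLib

/-!
# Time-dependent sheet integrals `I(t) = ∫ Λ(t, W, √(ε(t)+|W|²)) d⁴W` are `C²` on `[0, δ]` (ROAD A ENGINE-T, part 2)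

Topic `Geometry/ComplexHyperbolic`; namespace `Literature.Geometry.ComplexHyperbolic.BallModel`.  THEOREMS ONLY (no `def`, no instance, no notation, no axiom,
no named fact, no `sorry`).  Cell `pub/hodgecm-mathlib`, ENGINE T1 (crux H413 = `stmt-HodgeConjecture-24833`); floor-1½, count-neutral, under row (S-d) ∕ «SdArch» ED. 3 node N1
(`stub_ArchCentralLimitU21`); author F0P3a-p05 (g13), 2026-09-01.  Continues ★ `UnitBallSheetFamilyBounds` (the majorants); delivers the `C²[0,δ]` token that ★ p06
`ArchCentralLimitCompactWallValue.quarter_sub_eq_of_wallGerms` ((A4)-V) consumes for `ψ(t) = m(t)·Φ_Θ(k_t)` (after ★ p843337 packaging + the instantiation + A-p18's bridge).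

THE MATHEMATICS.  Datum `Λ : ℝ × ℂ² × ℝ → G` with `ContDiff ℝ 2 Λ` and `r²`-support bound `S`; sheet radius `ε` with derivative data `ε₁, ε₂` (`HasDerivAt` everywhere, `ε₂` continuous),
`ε ≥ 0` on `[0, ∞)`, `ε > 0` on `(0, T)`.  With `ρ = √(ε(t)+|W|²)`, `γ = (t, W, ρ)`, `γ′ = (1,0,ε₁(2ρ)⁻¹)`, `γ″ = (0,0,ε₂(2ρ)⁻¹ − ε₁²(4ρ³)⁻¹)` and the integrals
`I(t) = ∫ Λ(γ)`, `I₁(t) = ∫ DΛ(γ)[γ′]`, `I₂(t) = ∫ D²Λ(γ)[γ′,γ′] + DΛ(γ)[γ″]` (all over `ℂ²` with Lebesgue measure):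
  **for `0 < t < T`: `HasDerivAt I (I₁ t) t`, `HasDerivAt I₁ (I₂ t) t` (dominated differentiation with the ★ majorants `B‖W‖⁻¹𝟙`, `D‖W‖⁻³𝟙 ∈ L¹(ℝ⁴)`); `I, I₁, I₂` continuous on `[0,T]`;
  at `t = 0`: right-derivatives `I₁(0)`, `I₂(0)`; hence `ContDiffOn ℝ 2 I (Icc 0 δ)` for every `0 < δ < T`.**
Measurability at `t` with `ε(t) = 0` (the cone) is obtained from continuity OFF the origin `W = 0` (`ρ ≥ ‖W‖ > 0` there) and `W ≠ 0` a.e. — this sidesteps the strong-vs-norm topology of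
`E →L (E →L G)` (no `PseudoMetrizableSpace` instance needed).

* §1 `continuous_family_zero`, `aestronglyMeasurable_family_one`, `aestronglyMeasurable_of_continuousOn_ne_zero`, `continuousOn_family_two`, `aestronglyMeasurable_family_two`,
  `continuousOn_family_one_param`, `continuousOn_family_two_param`;
* §2 **`hasDerivAt_integral_family`**, **`hasDerivAt_integral_family_deriv`**, **`continuousOn_integral_family_zero ∕ one ∕ two`** (on `Icc 0 T`);
* §3 **`hasDerivWithinAt_integral_family_zero ∕ one`** (one-sided at `0`), **`contDiffOn_two_integral_family`** (`ContDiffOn ℝ 2 I (Icc 0 δ)`).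
HONEST LABEL: HC_CM is proved only modulo the printed citations until rung 0 closes; this file is real analysis over ★ ball-model files and pays nothing by itself.

## References
* [Rogawski1990] J. D. Rogawski, *Automorphic Representations of Unitary Groups in Three Variables*, Ann. of Math. Stud. 123 (1990), §8.4 pp. 126–127.
* [Rudin1980] W. Rudin, *Function Theory in the Unit Ball of ℂⁿ* (1980), §1.4.
-/

noncomputable section

open MeasureTheory MeasureTheory.Measure Set Filter Topology Metric
open scoped ENNReal

namespace Literature.Geometry.ComplexHyperbolic.BallModel

section EngineT

variable {G : Type*} [NormedAddCommGroup G] [NormedSpace ℝ G] {Λ : ℝ × (Fin 2 → ℂ) × ℝ → G} {S T : ℝ} {ε ε₁ ε₂ : ℝ → ℝ}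

/-! ### §1 Measurability and continuity of the three integrands -/

omit [NormedSpace ℝ G] in
/-- The order-0 integrand is continuous in `W` (any `t`). [cite: Rudin1980, §1.4] -/
theorem continuous_family_zero (hΛ : Continuous Λ) (t : ℝ) : Continuous fun W : Fin 2 → ℂ => Λ (t, W, Real.sqrt (ε t + nsq W)) :=
  hΛ.comp (continuous_const.prodMk (continuous_id.prodMk ((continuous_const.add continuous_fun_nsq).sqrt)))

/-- The order-1 integrand is a.e.-strongly measurable in `W` (any `t`). [cite: Rudin1980, §1.4] -/
theorem aestronglyMeasurable_family_one (hΛ : ContDiff ℝ 2 Λ) (t : ℝ) :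
    AEStronglyMeasurable (fun W : Fin 2 → ℂ => (fderiv ℝ Λ (t, W, Real.sqrt (ε t + nsq W)))
      ((1 : ℝ), (0 : Fin 2 → ℂ), ε₁ t * (2 * Real.sqrt (ε t + nsq W))⁻¹)) volume := by
  have hA : Continuous fun W : Fin 2 → ℂ => fderiv ℝ Λ (t, W, Real.sqrt (ε t + nsq W)) :=
    (hΛ.continuous_fderiv two_ne_zero).comp (continuous_const.prodMk (continuous_id.prodMk ((continuous_const.add continuous_fun_nsq).sqrt)))
  have hv : Measurable fun W : Fin 2 → ℂ => (((1 : ℝ), (0 : Fin 2 → ℂ), ε₁ t * (2 * Real.sqrt (ε t + nsq W))⁻¹) : ℝ × (Fin 2 → ℂ) × ℝ) :=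
    measurable_const.prodMk (measurable_const.prodMk (measurable_const.mul (continuous_const.mul ((continuous_const.add continuous_fun_nsq).sqrt)).measurable.inv))
  exact (isBoundedBilinearMap_apply (𝕜 := ℝ) (E := ℝ × (Fin 2 → ℂ) × ℝ) (F := G)).continuous.comp_aestronglyMeasurable
    (hA.aestronglyMeasurable.prodMk hv.aestronglyMeasurable)

/-- A function on `ℂ²` continuous off the origin is a.e.-strongly measurable (Lebesgue measure has no atom at `0`). [cite: Rudin1980, §1.4] -/
theorem aestronglyMeasurable_of_continuousOn_ne_zero {β : Type*} [TopologicalSpace β] [TopologicalSpace.PseudoMetrizableSpace β]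
    {f : (Fin 2 → ℂ) → β} (hf : ContinuousOn f {W : Fin 2 → ℂ | W ≠ 0}) : AEStronglyMeasurable f (volume : Measure (Fin 2 → ℂ)) := by
  have hs : MeasurableSet {W : Fin 2 → ℂ | W ≠ 0} := (measurableSet_singleton (0 : Fin 2 → ℂ)).compl
  rw [← Measure.restrict_eq_self_of_ae_mem (ae_ne_zero_volume_fin_two_complex)]
  exact hf.aestronglyMeasurable hs

/-- The order-2 integrand is continuous off `W = 0` when `ε(t) ≥ 0`. [cite: Rudin1980, §1.4] -/
theorem continuousOn_family_two (hΛ : ContDiff ℝ 2 Λ) {t : ℝ} (hεt : 0 ≤ ε t) :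
    ContinuousOn (fun W : Fin 2 → ℂ =>
      (fderiv ℝ (fderiv ℝ Λ) (t, W, Real.sqrt (ε t + nsq W)) ((1 : ℝ), (0 : Fin 2 → ℂ), ε₁ t * (2 * Real.sqrt (ε t + nsq W))⁻¹))
          ((1 : ℝ), (0 : Fin 2 → ℂ), ε₁ t * (2 * Real.sqrt (ε t + nsq W))⁻¹) +
        (fderiv ℝ Λ (t, W, Real.sqrt (ε t + nsq W)))
          ((0 : ℝ), (0 : Fin 2 → ℂ), ε₂ t * (2 * Real.sqrt (ε t + nsq W))⁻¹ - ε₁ t ^ 2 * (4 * Real.sqrt (ε t + nsq W) ^ 3)⁻¹)) {W : Fin 2 → ℂ | W ≠ 0} := by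
  have h1 := hΛ.fderiv_right (m := 1) le_rfl
  have hρc : Continuous fun W : Fin 2 → ℂ => Real.sqrt (ε t + nsq W) := (continuous_const.add continuous_fun_nsq).sqrt
  have hne : ∀ W ∈ {W : Fin 2 → ℂ | W ≠ 0}, Real.sqrt (ε t + nsq W) ≠ 0 := fun W hW =>
    (Real.sqrt_pos.2 (by have := nsq_pos_of_ne_zero (show W ≠ 0 from hW); linarith)).ne'
  have hγ : Continuous fun W : Fin 2 → ℂ => ((t, W, Real.sqrt (ε t + nsq W)) : ℝ × (Fin 2 → ℂ) × ℝ) :=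
    continuous_const.prodMk (continuous_id.prodMk hρc)
  have hA : Continuous fun W : Fin 2 → ℂ => fderiv ℝ Λ (t, W, Real.sqrt (ε t + nsq W)) := (hΛ.continuous_fderiv two_ne_zero).comp hγ
  have hA2 : Continuous fun W : Fin 2 → ℂ => fderiv ℝ (fderiv ℝ Λ) (t, W, Real.sqrt (ε t + nsq W)) := (h1.continuous_fderiv one_ne_zero).comp hγ
  have hv : ContinuousOn (fun W : Fin 2 → ℂ => (((1 : ℝ), (0 : Fin 2 → ℂ), ε₁ t * (2 * Real.sqrt (ε t + nsq W))⁻¹) : ℝ × (Fin 2 → ℂ) × ℝ))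
      {W : Fin 2 → ℂ | W ≠ 0} :=
    continuousOn_const.prodMk (continuousOn_const.prodMk (continuousOn_const.mul
      (((continuous_const.mul hρc).continuousOn).inv₀ fun W hW => mul_ne_zero two_ne_zero (hne W hW))))
  have hw : ContinuousOn (fun W : Fin 2 → ℂ => (((0 : ℝ), (0 : Fin 2 → ℂ),
      ε₂ t * (2 * Real.sqrt (ε t + nsq W))⁻¹ - ε₁ t ^ 2 * (4 * Real.sqrt (ε t + nsq W) ^ 3)⁻¹) : ℝ × (Fin 2 → ℂ) × ℝ)) {W : Fin 2 → ℂ | W ≠ 0} :=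
    continuousOn_const.prodMk (continuousOn_const.prodMk ((continuousOn_const.mul
      (((continuous_const.mul hρc).continuousOn).inv₀ fun W hW => mul_ne_zero two_ne_zero (hne W hW))).sub
      (continuousOn_const.mul (((continuous_const.mul (hρc.pow 3)).continuousOn).inv₀ fun W hW =>
        mul_ne_zero (by norm_num) (pow_ne_zero 3 (hne W hW))))))
  have happ := (isBoundedBilinearMap_apply (𝕜 := ℝ) (E := ℝ × (Fin 2 → ℂ) × ℝ) (F := G)).continuous
  have happ2 := (isBoundedBilinearMap_apply (𝕜 := ℝ) (E := ℝ × (Fin 2 → ℂ) × ℝ) (F := ℝ × (Fin 2 → ℂ) × ℝ →L[ℝ] G)).continuous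
  have hB : ContinuousOn (fun W : Fin 2 → ℂ => fderiv ℝ (fderiv ℝ Λ) (t, W, Real.sqrt (ε t + nsq W))
      ((1 : ℝ), (0 : Fin 2 → ℂ), ε₁ t * (2 * Real.sqrt (ε t + nsq W))⁻¹)) {W : Fin 2 → ℂ | W ≠ 0} :=
    happ2.comp_continuousOn (hA2.continuousOn.prodMk hv)
  exact (happ.comp_continuousOn (hB.prodMk hv)).add (happ.comp_continuousOn (hA.continuousOn.prodMk hw))

/-- The order-2 integrand is a.e.-strongly measurable in `W` when `ε(t) ≥ 0`. [cite: Rudin1980, §1.4] -/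
theorem aestronglyMeasurable_family_two (hΛ : ContDiff ℝ 2 Λ) {t : ℝ} (hεt : 0 ≤ ε t) :
    AEStronglyMeasurable (fun W : Fin 2 → ℂ =>
      (fderiv ℝ (fderiv ℝ Λ) (t, W, Real.sqrt (ε t + nsq W)) ((1 : ℝ), (0 : Fin 2 → ℂ), ε₁ t * (2 * Real.sqrt (ε t + nsq W))⁻¹))
          ((1 : ℝ), (0 : Fin 2 → ℂ), ε₁ t * (2 * Real.sqrt (ε t + nsq W))⁻¹) +
        (fderiv ℝ Λ (t, W, Real.sqrt (ε t + nsq W)))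
          ((0 : ℝ), (0 : Fin 2 → ℂ), ε₂ t * (2 * Real.sqrt (ε t + nsq W))⁻¹ - ε₁ t ^ 2 * (4 * Real.sqrt (ε t + nsq W) ^ 3)⁻¹)) volume :=
  aestronglyMeasurable_of_continuousOn_ne_zero (continuousOn_family_two (ε₁ := ε₁) (ε₂ := ε₂) hΛ hεt)

/-- For `W ≠ 0` the order-1 integrand is continuous in `t ∈ [0,∞)` when `ε ≥ 0` there (`ε, ε₁` continuous). [cite: Rudin1980, §1.4] -/
theorem continuousOn_family_one_param (hΛ : ContDiff ℝ 2 Λ) (hεc : Continuous ε) (hε₁c : Continuous ε₁) (hε0 : ∀ t ∈ Icc (0 : ℝ) T, 0 ≤ ε t)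
    {W : Fin 2 → ℂ} (hW : W ≠ 0) :
    ContinuousOn (fun t : ℝ => (fderiv ℝ Λ (t, W, Real.sqrt (ε t + nsq W))) ((1 : ℝ), (0 : Fin 2 → ℂ), ε₁ t * (2 * Real.sqrt (ε t + nsq W))⁻¹)) (Icc 0 T) := by
  have hn : 0 < nsq W := nsq_pos_of_ne_zero hW
  have hρc : Continuous fun t : ℝ => Real.sqrt (ε t + nsq W) := (hεc.add continuous_const).sqrt
  have hne : ∀ t ∈ Icc (0 : ℝ) T, Real.sqrt (ε t + nsq W) ≠ 0 := fun t ht =>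
    (Real.sqrt_pos.2 (by have := hε0 t ht; linarith)).ne'
  have hA : Continuous fun t : ℝ => fderiv ℝ Λ (t, W, Real.sqrt (ε t + nsq W)) :=
    (hΛ.continuous_fderiv two_ne_zero).comp (continuous_id.prodMk (continuous_const.prodMk hρc))
  have hv : ContinuousOn (fun t : ℝ => (((1 : ℝ), (0 : Fin 2 → ℂ), ε₁ t * (2 * Real.sqrt (ε t + nsq W))⁻¹) : ℝ × (Fin 2 → ℂ) × ℝ)) (Icc 0 T) :=
    continuousOn_const.prodMk (continuousOn_const.prodMk (hε₁c.continuousOn.mul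
      (((continuous_const.mul hρc).continuousOn).inv₀ fun t ht => mul_ne_zero two_ne_zero (hne t ht))))
  exact (isBoundedBilinearMap_apply (𝕜 := ℝ) (E := ℝ × (Fin 2 → ℂ) × ℝ) (F := G)).continuous.comp_continuousOn (hA.continuousOn.prodMk hv)

/-- For `W ≠ 0` the order-2 integrand is continuous in `t ∈ [0,∞)` when `ε ≥ 0` there (`ε, ε₁, ε₂` continuous). [cite: Rudin1980, §1.4] -/
theorem continuousOn_family_two_param (hΛ : ContDiff ℝ 2 Λ) (hεc : Continuous ε) (hε₁c : Continuous ε₁) (hε₂c : Continuous ε₂)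
    (hε0 : ∀ t ∈ Icc (0 : ℝ) T, 0 ≤ ε t) {W : Fin 2 → ℂ} (hW : W ≠ 0) :
    ContinuousOn (fun t : ℝ =>
      (fderiv ℝ (fderiv ℝ Λ) (t, W, Real.sqrt (ε t + nsq W)) ((1 : ℝ), (0 : Fin 2 → ℂ), ε₁ t * (2 * Real.sqrt (ε t + nsq W))⁻¹))
          ((1 : ℝ), (0 : Fin 2 → ℂ), ε₁ t * (2 * Real.sqrt (ε t + nsq W))⁻¹) +
        (fderiv ℝ Λ (t, W, Real.sqrt (ε t + nsq W)))
          ((0 : ℝ), (0 : Fin 2 → ℂ), ε₂ t * (2 * Real.sqrt (ε t + nsq W))⁻¹ - ε₁ t ^ 2 * (4 * Real.sqrt (ε t + nsq W) ^ 3)⁻¹)) (Icc 0 T) := by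
  have h1 := hΛ.fderiv_right (m := 1) le_rfl
  have hn : 0 < nsq W := nsq_pos_of_ne_zero hW
  have hρc : Continuous fun t : ℝ => Real.sqrt (ε t + nsq W) := (hεc.add continuous_const).sqrt
  have hne : ∀ t ∈ Icc (0 : ℝ) T, Real.sqrt (ε t + nsq W) ≠ 0 := fun t ht =>
    (Real.sqrt_pos.2 (by have := hε0 t ht; linarith)).ne'
  have hγ : Continuous fun t : ℝ => ((t, W, Real.sqrt (ε t + nsq W)) : ℝ × (Fin 2 → ℂ) × ℝ) := continuous_id.prodMk (continuous_const.prodMk hρc)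
  have hA : Continuous fun t : ℝ => fderiv ℝ Λ (t, W, Real.sqrt (ε t + nsq W)) := (hΛ.continuous_fderiv two_ne_zero).comp hγ
  have hA2 : Continuous fun t : ℝ => fderiv ℝ (fderiv ℝ Λ) (t, W, Real.sqrt (ε t + nsq W)) := (h1.continuous_fderiv one_ne_zero).comp hγ
  have hv : ContinuousOn (fun t : ℝ => (((1 : ℝ), (0 : Fin 2 → ℂ), ε₁ t * (2 * Real.sqrt (ε t + nsq W))⁻¹) : ℝ × (Fin 2 → ℂ) × ℝ)) (Icc 0 T) :=
    continuousOn_const.prodMk (continuousOn_const.prodMk (hε₁c.continuousOn.mul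
      (((continuous_const.mul hρc).continuousOn).inv₀ fun t ht => mul_ne_zero two_ne_zero (hne t ht))))
  have hw : ContinuousOn (fun t : ℝ => (((0 : ℝ), (0 : Fin 2 → ℂ),
      ε₂ t * (2 * Real.sqrt (ε t + nsq W))⁻¹ - ε₁ t ^ 2 * (4 * Real.sqrt (ε t + nsq W) ^ 3)⁻¹) : ℝ × (Fin 2 → ℂ) × ℝ)) (Icc 0 T) :=
    continuousOn_const.prodMk (continuousOn_const.prodMk ((hε₂c.continuousOn.mul
      (((continuous_const.mul hρc).continuousOn).inv₀ fun t ht => mul_ne_zero two_ne_zero (hne t ht))).sub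
      ((hε₁c.pow 2).continuousOn.mul (((continuous_const.mul (hρc.pow 3)).continuousOn).inv₀ fun t ht =>
        mul_ne_zero (by norm_num) (pow_ne_zero 3 (hne t ht))))))
  have happ := (isBoundedBilinearMap_apply (𝕜 := ℝ) (E := ℝ × (Fin 2 → ℂ) × ℝ) (F := G)).continuous
  have happ2 := (isBoundedBilinearMap_apply (𝕜 := ℝ) (E := ℝ × (Fin 2 → ℂ) × ℝ) (F := ℝ × (Fin 2 → ℂ) × ℝ →L[ℝ] G)).continuous
  have hB : ContinuousOn (fun t : ℝ => fderiv ℝ (fderiv ℝ Λ) (t, W, Real.sqrt (ε t + nsq W))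
      ((1 : ℝ), (0 : Fin 2 → ℂ), ε₁ t * (2 * Real.sqrt (ε t + nsq W))⁻¹)) (Icc 0 T) :=
    happ2.comp_continuousOn (hA2.continuousOn.prodMk hv)
  exact (happ.comp_continuousOn (hB.prodMk hv)).add (happ.comp_continuousOn (hA.continuousOn.prodMk hw))

/-! ### §2 The sheet-family integral `I(t) = ∫ Λ(t, W, √(ε(t)+|W|²)) d⁴W` is `C²` on `[0, T]` -/

/-- **FIRST DERIVATIVE UNDER THE INTEGRAL (`0 < t < T`)**: `I′(t) = ∫ DΛ(γ)[γ′] d⁴W`, and that integrand is integrable. [cite: Rogawski1990, §8.4 pp. 126–127] [cite: Rudin1980, §1.4] -/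
theorem hasDerivAt_integral_family (hΛ : ContDiff ℝ 2 Λ) (hS : ∀ (t : ℝ) (W : Fin 2 → ℂ) (r : ℝ), S ≤ r ^ 2 → Λ (t, W, r) = 0)
    (hε : ∀ t, HasDerivAt ε (ε₁ t) t) (hε₁c : Continuous ε₁) (hε0 : ∀ t ∈ Icc (0 : ℝ) T, 0 ≤ ε t) (hεpos : ∀ t ∈ Ioo (0 : ℝ) T, 0 < ε t)
    {t : ℝ} (ht : t ∈ Ioo (0 : ℝ) T) :
    Integrable (fun W : Fin 2 → ℂ => (fderiv ℝ Λ (t, W, Real.sqrt (ε t + nsq W))) ((1 : ℝ), (0 : Fin 2 → ℂ), ε₁ t * (2 * Real.sqrt (ε t + nsq W))⁻¹)) ∧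
      HasDerivAt (fun t : ℝ => ∫ W : Fin 2 → ℂ, Λ (t, W, Real.sqrt (ε t + nsq W)))
        (∫ W : Fin 2 → ℂ, (fderiv ℝ Λ (t, W, Real.sqrt (ε t + nsq W))) ((1 : ℝ), (0 : Fin 2 → ℂ), ε₁ t * (2 * Real.sqrt (ε t + nsq W))⁻¹)) t := by
  obtain ⟨C, -, hC⟩ := exists_bound_family_zero (T := T) hΛ.continuous hS hε0
  obtain ⟨B, -, hB⟩ := exists_bound_family_one (T := T) hΛ hS hε0 hε₁c.continuousOn
  have hs : Ioo (t / 2) T ∈ 𝓝 t := Ioo_mem_nhds (by linarith [ht.1]) ht.2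
  have hsub : ∀ x ∈ Ioo (t / 2) T, x ∈ Icc (0 : ℝ) T := fun x hx => ⟨by linarith [hx.1, ht.1], hx.2.le⟩
  refine hasDerivAt_integral_of_dominated_loc_of_deriv_le
    (F := fun (t : ℝ) (W : Fin 2 → ℂ) => Λ (t, W, Real.sqrt (ε t + nsq W)))
    (F' := fun (t : ℝ) (W : Fin 2 → ℂ) => (fderiv ℝ Λ (t, W, Real.sqrt (ε t + nsq W))) ((1 : ℝ), (0 : Fin 2 → ℂ), ε₁ t * (2 * Real.sqrt (ε t + nsq W))⁻¹))
    hs (Filter.Eventually.of_forall fun x => (continuous_family_zero hΛ.continuous x).aestronglyMeasurable) ?_ (aestronglyMeasurable_family_one hΛ t) ?_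
    (integrable_indicator_nsq_le_mul_norm_rpow_neg S B (by norm_num : (1 : ℝ) < 4)) ?_
  · exact (integrable_indicator_nsq_le_const S C).mono' (continuous_family_zero hΛ.continuous t).aestronglyMeasurable
      (Filter.Eventually.of_forall fun W => hC t ⟨ht.1.le, ht.2.le⟩ W)
  · filter_upwards [ae_ne_zero_volume_fin_two_complex] with W hW x hx
    exact hB x (hsub x hx) W hW
  · refine Filter.Eventually.of_forall fun W x hx => ?_
    have hx0 : 0 < ε x + nsq W := by have := hεpos x ⟨by linarith [hx.1, ht.1], hx.2⟩; linarith [nsq_nonneg W]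
    exact hasDerivAt_comp_curve hΛ hε W hx0

/-- **SECOND DERIVATIVE UNDER THE INTEGRAL (`0 < t < T`)**: `I₁′(t) = ∫ [D²Λ(γ)[γ′,γ′] + DΛ(γ)[γ″]] d⁴W`, integrand integrable. [cite: Rogawski1990, §8.4 pp. 126–127] [cite: Rudin1980, §1.4] -/
theorem hasDerivAt_integral_family_deriv (hΛ : ContDiff ℝ 2 Λ) (hS : ∀ (t : ℝ) (W : Fin 2 → ℂ) (r : ℝ), S ≤ r ^ 2 → Λ (t, W, r) = 0)
    (hε : ∀ t, HasDerivAt ε (ε₁ t) t) (hε' : ∀ t, HasDerivAt ε₁ (ε₂ t) t) (hε₂c : Continuous ε₂)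
    (hε0 : ∀ t ∈ Icc (0 : ℝ) T, 0 ≤ ε t) (hεpos : ∀ t ∈ Ioo (0 : ℝ) T, 0 < ε t) {t : ℝ} (ht : t ∈ Ioo (0 : ℝ) T) :
    Integrable (fun W : Fin 2 → ℂ =>
      (fderiv ℝ (fderiv ℝ Λ) (t, W, Real.sqrt (ε t + nsq W)) ((1 : ℝ), (0 : Fin 2 → ℂ), ε₁ t * (2 * Real.sqrt (ε t + nsq W))⁻¹))
          ((1 : ℝ), (0 : Fin 2 → ℂ), ε₁ t * (2 * Real.sqrt (ε t + nsq W))⁻¹) +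
        (fderiv ℝ Λ (t, W, Real.sqrt (ε t + nsq W)))
          ((0 : ℝ), (0 : Fin 2 → ℂ), ε₂ t * (2 * Real.sqrt (ε t + nsq W))⁻¹ - ε₁ t ^ 2 * (4 * Real.sqrt (ε t + nsq W) ^ 3)⁻¹)) ∧
      HasDerivAt (fun t : ℝ => ∫ W : Fin 2 → ℂ, (fderiv ℝ Λ (t, W, Real.sqrt (ε t + nsq W))) ((1 : ℝ), (0 : Fin 2 → ℂ), ε₁ t * (2 * Real.sqrt (ε t + nsq W))⁻¹))
        (∫ W : Fin 2 → ℂ, ((fderiv ℝ (fderiv ℝ Λ) (t, W, Real.sqrt (ε t + nsq W)) ((1 : ℝ), (0 : Fin 2 → ℂ), ε₁ t * (2 * Real.sqrt (ε t + nsq W))⁻¹))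
          ((1 : ℝ), (0 : Fin 2 → ℂ), ε₁ t * (2 * Real.sqrt (ε t + nsq W))⁻¹) +
        (fderiv ℝ Λ (t, W, Real.sqrt (ε t + nsq W)))
          ((0 : ℝ), (0 : Fin 2 → ℂ), ε₂ t * (2 * Real.sqrt (ε t + nsq W))⁻¹ - ε₁ t ^ 2 * (4 * Real.sqrt (ε t + nsq W) ^ 3)⁻¹))) t := by
  have hε₁c : Continuous ε₁ := continuous_iff_continuousAt.2 fun t => (hε' t).continuousAt
  obtain ⟨D, -, hD⟩ := exists_bound_family_two (T := T) hΛ hS hε0 hε₁c.continuousOn hε₂c.continuousOn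
  have hs : Ioo (t / 2) T ∈ 𝓝 t := Ioo_mem_nhds (by linarith [ht.1]) ht.2
  have hsub : ∀ x ∈ Ioo (t / 2) T, x ∈ Icc (0 : ℝ) T := fun x hx => ⟨by linarith [hx.1, ht.1], hx.2.le⟩
  refine hasDerivAt_integral_of_dominated_loc_of_deriv_le
    (F := fun (t : ℝ) (W : Fin 2 → ℂ) => (fderiv ℝ Λ (t, W, Real.sqrt (ε t + nsq W))) ((1 : ℝ), (0 : Fin 2 → ℂ), ε₁ t * (2 * Real.sqrt (ε t + nsq W))⁻¹))
    (F' := fun (t : ℝ) (W : Fin 2 → ℂ) =>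
      (fderiv ℝ (fderiv ℝ Λ) (t, W, Real.sqrt (ε t + nsq W)) ((1 : ℝ), (0 : Fin 2 → ℂ), ε₁ t * (2 * Real.sqrt (ε t + nsq W))⁻¹))
          ((1 : ℝ), (0 : Fin 2 → ℂ), ε₁ t * (2 * Real.sqrt (ε t + nsq W))⁻¹) +
        (fderiv ℝ Λ (t, W, Real.sqrt (ε t + nsq W)))
          ((0 : ℝ), (0 : Fin 2 → ℂ), ε₂ t * (2 * Real.sqrt (ε t + nsq W))⁻¹ - ε₁ t ^ 2 * (4 * Real.sqrt (ε t + nsq W) ^ 3)⁻¹))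
    hs (Filter.Eventually.of_forall fun x => aestronglyMeasurable_family_one hΛ x)
    (hasDerivAt_integral_family hΛ hS hε hε₁c hε0 hεpos ht).1 (aestronglyMeasurable_family_two hΛ (hε0 t ⟨ht.1.le, ht.2.le⟩)) ?_
    (integrable_indicator_nsq_le_mul_norm_rpow_neg S D (by norm_num : (3 : ℝ) < 4)) ?_
  · filter_upwards [ae_ne_zero_volume_fin_two_complex] with W hW x hx
    exact hD x (hsub x hx) W hW
  · refine Filter.Eventually.of_forall fun W x hx => ?_
    have hx0 : 0 < ε x + nsq W := by have := hεpos x ⟨by linarith [hx.1, ht.1], hx.2⟩; linarith [nsq_nonneg W]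
    exact hasDerivAt_fderiv_comp_curve hΛ hε hε' W hx0

/-- **CONTINUITY OF `I` ON `[0, T]`.** [cite: Rogawski1990, §8.4 pp. 126–127] [cite: Rudin1980, §1.4] -/
theorem continuousOn_integral_family_zero (hΛ : Continuous Λ) (hS : ∀ (t : ℝ) (W : Fin 2 → ℂ) (r : ℝ), S ≤ r ^ 2 → Λ (t, W, r) = 0)
    (hεc : Continuous ε) (hε0 : ∀ t ∈ Icc (0 : ℝ) T, 0 ≤ ε t) :
    ContinuousOn (fun t : ℝ => ∫ W : Fin 2 → ℂ, Λ (t, W, Real.sqrt (ε t + nsq W))) (Icc 0 T) := by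
  obtain ⟨C, -, hC⟩ := exists_bound_family_zero (T := T) hΛ hS hε0
  refine continuousOn_of_dominated (fun t _ => (continuous_family_zero hΛ t).aestronglyMeasurable)
    (fun t ht => Filter.Eventually.of_forall fun W => hC t ht W) (integrable_indicator_nsq_le_const S C)
    (Filter.Eventually.of_forall fun W => ?_)
  exact (hΛ.comp (continuous_id.prodMk (continuous_const.prodMk ((hεc.add continuous_const).sqrt)))).continuousOn

/-- **CONTINUITY OF `I₁` ON `[0, T]`.** [cite: Rogawski1990, §8.4 pp. 126–127] [cite: Rudin1980, §1.4] -/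
theorem continuousOn_integral_family_one (hΛ : ContDiff ℝ 2 Λ) (hS : ∀ (t : ℝ) (W : Fin 2 → ℂ) (r : ℝ), S ≤ r ^ 2 → Λ (t, W, r) = 0)
    (hεc : Continuous ε) (hε₁c : Continuous ε₁) (hε0 : ∀ t ∈ Icc (0 : ℝ) T, 0 ≤ ε t) :
    ContinuousOn (fun t : ℝ => ∫ W : Fin 2 → ℂ, (fderiv ℝ Λ (t, W, Real.sqrt (ε t + nsq W)))
      ((1 : ℝ), (0 : Fin 2 → ℂ), ε₁ t * (2 * Real.sqrt (ε t + nsq W))⁻¹)) (Icc 0 T) := by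
  obtain ⟨B, -, hB⟩ := exists_bound_family_one (T := T) hΛ hS hε0 hε₁c.continuousOn
  refine continuousOn_of_dominated (fun t _ => aestronglyMeasurable_family_one hΛ t) (fun t ht => ?_)
    (integrable_indicator_nsq_le_mul_norm_rpow_neg S B (by norm_num : (1 : ℝ) < 4)) ?_
  · filter_upwards [ae_ne_zero_volume_fin_two_complex] with W hW
    exact hB t ht W hW
  · filter_upwards [ae_ne_zero_volume_fin_two_complex] with W hW
    exact continuousOn_family_one_param hΛ hεc hε₁c hε0 hW

/-- **CONTINUITY OF `I₂` ON `[0, T]`.** [cite: Rogawski1990, §8.4 pp. 126–127] [cite: Rudin1980, §1.4] -/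
theorem continuousOn_integral_family_two (hΛ : ContDiff ℝ 2 Λ) (hS : ∀ (t : ℝ) (W : Fin 2 → ℂ) (r : ℝ), S ≤ r ^ 2 → Λ (t, W, r) = 0)
    (hεc : Continuous ε) (hε₁c : Continuous ε₁) (hε₂c : Continuous ε₂) (hε0 : ∀ t ∈ Icc (0 : ℝ) T, 0 ≤ ε t) :
    ContinuousOn (fun t : ℝ => ∫ W : Fin 2 → ℂ, ((fderiv ℝ (fderiv ℝ Λ) (t, W, Real.sqrt (ε t + nsq W))
        ((1 : ℝ), (0 : Fin 2 → ℂ), ε₁ t * (2 * Real.sqrt (ε t + nsq W))⁻¹)) ((1 : ℝ), (0 : Fin 2 → ℂ), ε₁ t * (2 * Real.sqrt (ε t + nsq W))⁻¹) +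
      (fderiv ℝ Λ (t, W, Real.sqrt (ε t + nsq W)))
        ((0 : ℝ), (0 : Fin 2 → ℂ), ε₂ t * (2 * Real.sqrt (ε t + nsq W))⁻¹ - ε₁ t ^ 2 * (4 * Real.sqrt (ε t + nsq W) ^ 3)⁻¹))) (Icc 0 T) := by
  obtain ⟨D, -, hD⟩ := exists_bound_family_two (T := T) hΛ hS hε0 hε₁c.continuousOn hε₂c.continuousOn
  refine continuousOn_of_dominated (fun t ht => aestronglyMeasurable_family_two hΛ (hε0 t ht)) (fun t ht => ?_)
    (integrable_indicator_nsq_le_mul_norm_rpow_neg S D (by norm_num : (3 : ℝ) < 4)) ?_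
  · filter_upwards [ae_ne_zero_volume_fin_two_complex] with W hW
    exact hD t ht W hW
  · filter_upwards [ae_ne_zero_volume_fin_two_complex] with W hW
    exact continuousOn_family_two_param hΛ hεc hε₁c hε₂c hε0 hW

/-! ### §3 One-sided derivatives at `t = 0` and the `C²[0, δ]` packaging -/

/-- **ONE-SIDED FIRST DERIVATIVE AT `t = 0`**: `I` has right-derivative `I₁(0)` within `[0, ∞)` (`0 < T`). [cite: Rogawski1990, §8.4 pp. 126–127] [cite: Rudin1980, §1.4] -/
theorem hasDerivWithinAt_integral_family_zero (hΛ : ContDiff ℝ 2 Λ) (hS : ∀ (t : ℝ) (W : Fin 2 → ℂ) (r : ℝ), S ≤ r ^ 2 → Λ (t, W, r) = 0)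
    (hε : ∀ t, HasDerivAt ε (ε₁ t) t) (hε₁c : Continuous ε₁) (hε0 : ∀ t ∈ Icc (0 : ℝ) T, 0 ≤ ε t) (hεpos : ∀ t ∈ Ioo (0 : ℝ) T, 0 < ε t)
    (hT : 0 < T) :
    HasDerivWithinAt (fun t : ℝ => ∫ W : Fin 2 → ℂ, Λ (t, W, Real.sqrt (ε t + nsq W)))
      (∫ W : Fin 2 → ℂ, (fderiv ℝ Λ (0, W, Real.sqrt (ε 0 + nsq W))) ((1 : ℝ), (0 : Fin 2 → ℂ), ε₁ 0 * (2 * Real.sqrt (ε 0 + nsq W))⁻¹)) (Ici 0) 0 := by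
  have hεc : Continuous ε := continuous_iff_continuousAt.2 fun t => (hε t).continuousAt
  have hI := fun (x : ℝ) (hx : x ∈ Ioo (0 : ℝ) T) => (hasDerivAt_integral_family hΛ hS hε hε₁c hε0 hεpos hx).2
  have h0 : (0 : ℝ) ∈ Icc (0 : ℝ) T := ⟨le_rfl, hT.le⟩
  have hsub : Ioo (0 : ℝ) T ⊆ Icc 0 T := Ioo_subset_Icc_self
  have hmem : Ioo (0 : ℝ) T ∈ 𝓝[>] (0 : ℝ) := Ioo_mem_nhdsGT hT
  have hD : HasDerivWithinAt (fun t : ℝ => ∫ W : Fin 2 → ℂ, Λ (t, W, Real.sqrt (ε t + nsq W)))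
      (∫ W : Fin 2 → ℂ, (fderiv ℝ Λ (0, W, Real.sqrt (ε 0 + nsq W))) ((1 : ℝ), (0 : Fin 2 → ℂ), ε₁ 0 * (2 * Real.sqrt (ε 0 + nsq W))⁻¹)) (Ici 0) 0 := by
    refine hasDerivWithinAt_Ici_of_tendsto_deriv (s := Ioo 0 T) (fun x hx => (hI x hx).differentiableAt.differentiableWithinAt)
      (((continuousOn_integral_family_zero hΛ.continuous hS hεc hε0).continuousWithinAt h0).mono hsub) hmem ?_
    have h1 := ((continuousOn_integral_family_one hΛ hS hεc hε₁c hε0).continuousWithinAt h0).tendsto.mono_left (nhdsWithin_mono _ hsub)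
    rw [nhdsWithin_Ioo_eq_nhdsGT hT] at h1
    refine h1.congr' ?_
    filter_upwards [hmem] with x hx
    exact (hI x hx).deriv.symm
  exact hD

/-- **ONE-SIDED SECOND DERIVATIVE AT `t = 0`**: `I₁` has right-derivative `I₂(0)` within `[0, ∞)`. [cite: Rogawski1990, §8.4 pp. 126–127] [cite: Rudin1980, §1.4] -/
theorem hasDerivWithinAt_integral_family_one (hΛ : ContDiff ℝ 2 Λ) (hS : ∀ (t : ℝ) (W : Fin 2 → ℂ) (r : ℝ), S ≤ r ^ 2 → Λ (t, W, r) = 0)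
    (hε : ∀ t, HasDerivAt ε (ε₁ t) t) (hε' : ∀ t, HasDerivAt ε₁ (ε₂ t) t) (hε₂c : Continuous ε₂)
    (hε0 : ∀ t ∈ Icc (0 : ℝ) T, 0 ≤ ε t) (hεpos : ∀ t ∈ Ioo (0 : ℝ) T, 0 < ε t) (hT : 0 < T) :
    HasDerivWithinAt (fun t : ℝ => ∫ W : Fin 2 → ℂ, (fderiv ℝ Λ (t, W, Real.sqrt (ε t + nsq W))) ((1 : ℝ), (0 : Fin 2 → ℂ), ε₁ t * (2 * Real.sqrt (ε t + nsq W))⁻¹))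
      (∫ W : Fin 2 → ℂ, ((fderiv ℝ (fderiv ℝ Λ) (0, W, Real.sqrt (ε 0 + nsq W)) ((1 : ℝ), (0 : Fin 2 → ℂ), ε₁ 0 * (2 * Real.sqrt (ε 0 + nsq W))⁻¹))
          ((1 : ℝ), (0 : Fin 2 → ℂ), ε₁ 0 * (2 * Real.sqrt (ε 0 + nsq W))⁻¹) +
        (fderiv ℝ Λ (0, W, Real.sqrt (ε 0 + nsq W)))
          ((0 : ℝ), (0 : Fin 2 → ℂ), ε₂ 0 * (2 * Real.sqrt (ε 0 + nsq W))⁻¹ - ε₁ 0 ^ 2 * (4 * Real.sqrt (ε 0 + nsq W) ^ 3)⁻¹))) (Ici 0) 0 := by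
  have hεc : Continuous ε := continuous_iff_continuousAt.2 fun t => (hε t).continuousAt
  have hε₁c : Continuous ε₁ := continuous_iff_continuousAt.2 fun t => (hε' t).continuousAt
  have hI := fun (x : ℝ) (hx : x ∈ Ioo (0 : ℝ) T) => (hasDerivAt_integral_family_deriv hΛ hS hε hε' hε₂c hε0 hεpos hx).2
  have h0 : (0 : ℝ) ∈ Icc (0 : ℝ) T := ⟨le_rfl, hT.le⟩
  have hsub : Ioo (0 : ℝ) T ⊆ Icc 0 T := Ioo_subset_Icc_self
  have hmem : Ioo (0 : ℝ) T ∈ 𝓝[>] (0 : ℝ) := Ioo_mem_nhdsGT hT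
  refine hasDerivWithinAt_Ici_of_tendsto_deriv (s := Ioo 0 T) (fun x hx => (hI x hx).differentiableAt.differentiableWithinAt)
    (((continuousOn_integral_family_one hΛ hS hεc hε₁c hε0).continuousWithinAt h0).mono hsub) hmem ?_
  have h1 := ((continuousOn_integral_family_two hΛ hS hεc hε₁c hε₂c hε0).continuousWithinAt h0).tendsto.mono_left (nhdsWithin_mono _ hsub)
  rw [nhdsWithin_Ioo_eq_nhdsGT hT] at h1
  refine h1.congr' ?_
  filter_upwards [hmem] with x hx
  exact (hI x hx).deriv.symm

/-- **THE SHEET-FAMILY INTEGRAL IS `C²` ON `[0, δ]`** (`0 < δ < T`), in Mathlib's `ContDiffOn` currency (the token the (A4)-V bookkeeping ★ `ArchCentralLimitCompactWallValue` consumes).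
[cite: Rogawski1990, §8.4 pp. 126–127] [cite: Rudin1980, §1.4] -/
theorem contDiffOn_two_integral_family (hΛ : ContDiff ℝ 2 Λ) (hS : ∀ (t : ℝ) (W : Fin 2 → ℂ) (r : ℝ), S ≤ r ^ 2 → Λ (t, W, r) = 0)
    (hε : ∀ t, HasDerivAt ε (ε₁ t) t) (hε' : ∀ t, HasDerivAt ε₁ (ε₂ t) t) (hε₂c : Continuous ε₂)
    (hε0 : ∀ t ∈ Icc (0 : ℝ) T, 0 ≤ ε t) (hεpos : ∀ t ∈ Ioo (0 : ℝ) T, 0 < ε t) {δ : ℝ} (hδ : 0 < δ) (hδT : δ < T) :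
    ContDiffOn ℝ 2 (fun t : ℝ => ∫ W : Fin 2 → ℂ, Λ (t, W, Real.sqrt (ε t + nsq W))) (Icc 0 δ) := by
  have hεc : Continuous ε := continuous_iff_continuousAt.2 fun t => (hε t).continuousAt
  have hε₁c : Continuous ε₁ := continuous_iff_continuousAt.2 fun t => (hε' t).continuousAt
  have hT : 0 < T := hδ.trans hδT
  have hU : UniqueDiffOn ℝ (Icc (0 : ℝ) δ) := uniqueDiffOn_Icc hδ
  -- names for the three functions
  set I : ℝ → G := fun t => ∫ W : Fin 2 → ℂ, Λ (t, W, Real.sqrt (ε t + nsq W)) with hIdef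
  set I₁ : ℝ → G := fun t => ∫ W : Fin 2 → ℂ, (fderiv ℝ Λ (t, W, Real.sqrt (ε t + nsq W)))
    ((1 : ℝ), (0 : Fin 2 → ℂ), ε₁ t * (2 * Real.sqrt (ε t + nsq W))⁻¹) with hI₁def
  set I₂ : ℝ → G := fun t => ∫ W : Fin 2 → ℂ, ((fderiv ℝ (fderiv ℝ Λ) (t, W, Real.sqrt (ε t + nsq W))
        ((1 : ℝ), (0 : Fin 2 → ℂ), ε₁ t * (2 * Real.sqrt (ε t + nsq W))⁻¹)) ((1 : ℝ), (0 : Fin 2 → ℂ), ε₁ t * (2 * Real.sqrt (ε t + nsq W))⁻¹) +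
      (fderiv ℝ Λ (t, W, Real.sqrt (ε t + nsq W)))
        ((0 : ℝ), (0 : Fin 2 → ℂ), ε₂ t * (2 * Real.sqrt (ε t + nsq W))⁻¹ - ε₁ t ^ 2 * (4 * Real.sqrt (ε t + nsq W) ^ 3)⁻¹)) with hI₂def
  -- first-order data within `Icc 0 δ`
  have hD1 : ∀ x ∈ Icc (0 : ℝ) δ, HasDerivWithinAt I (I₁ x) (Icc 0 δ) x := by
    intro x hx
    rcases eq_or_lt_of_le hx.1 with h0 | hpos
    · rw [← h0]
      exact (hasDerivWithinAt_integral_family_zero hΛ hS hε hε₁c hε0 hεpos hT).mono fun y hy => hy.1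
    · exact (hasDerivAt_integral_family hΛ hS hε hε₁c hε0 hεpos ⟨hpos, lt_of_le_of_lt hx.2 hδT⟩).2.hasDerivWithinAt
  have hD2 : ∀ x ∈ Icc (0 : ℝ) δ, HasDerivWithinAt I₁ (I₂ x) (Icc 0 δ) x := by
    intro x hx
    rcases eq_or_lt_of_le hx.1 with h0 | hpos
    · rw [← h0]
      exact (hasDerivWithinAt_integral_family_one hΛ hS hε hε' hε₂c hε0 hεpos hT).mono fun y hy => hy.1
    · exact (hasDerivAt_integral_family_deriv hΛ hS hε hε' hε₂c hε0 hεpos ⟨hpos, lt_of_le_of_lt hx.2 hδT⟩).2.hasDerivWithinAt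
  have hc2 : ContinuousOn I₂ (Icc 0 δ) := (continuousOn_integral_family_two hΛ hS hεc hε₁c hε₂c hε0).mono (Icc_subset_Icc_right hδT.le)
  have hd1 : ∀ x ∈ Icc (0 : ℝ) δ, derivWithin I (Icc 0 δ) x = I₁ x := fun x hx => (hD1 x hx).derivWithin (hU x hx)
  have hd2 : ∀ x ∈ Icc (0 : ℝ) δ, derivWithin I₁ (Icc 0 δ) x = I₂ x := fun x hx => (hD2 x hx).derivWithin (hU x hx)
  -- assemble
  have hone : ContDiffOn ℝ 1 I₁ (Icc 0 δ) := by
    rw [show (1 : WithTop ℕ∞) = 0 + 1 from (zero_add 1).symm, contDiffOn_succ_iff_derivWithin hU]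
    refine ⟨fun x hx => (hD2 x hx).differentiableWithinAt, fun h => absurd h (by simp), ?_⟩
    exact contDiffOn_zero.2 (hc2.congr fun x hx => hd2 x hx)
  rw [show (2 : WithTop ℕ∞) = 1 + 1 from (one_add_one_eq_two).symm, contDiffOn_succ_iff_derivWithin hU]
  refine ⟨fun x hx => (hD1 x hx).differentiableWithinAt, fun h => absurd h (by simp), ?_⟩
  exact hone.congr fun x hx => hd1 x hx

end EngineT

end Literature.Geometry.ComplexHyperbolic.BallModel

end
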